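import Mathlib
import Literature.AlgebraicGeometry.HodgeTheory.HodgeTypeExteriorProduct
import Literature.AlgebraicGeometry.HodgeTheory.HodgeTypeConjugation
import Literature.AlgebraicGeometry.HodgeTheory.AbelianVarietyEndomorphismsHOne
import Literature.AlgebraicGeometry.Motives.AbelianVarietyProjectiveChart

/-!
# Crux `HodgeAbelianVarieties` (stmt-HodgeConjecture-1333), line `cm-pivot-andre` — André with CM targets, module L3b: the rational symmetric-function operators `R_k`

For an endomorphism `Y` ("`θ`") of a complex abelian variety `B` and a degree `d`, this module builds linear operators
`R_k` (`k ≤ d`) on `Hᵈ(B(ℂ); ℂ)` which (i) preserve rational classes and Hodge types — they are ℚ-linear combinations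
and composites of the pull-backs `(x•𝟙 + Y)^*`, `x = 0, …, d` — and (ii) act on every joint eigenvector `t` of these
pull-backs with "conjugate multiset" `M` (`(x•𝟙 + Y)^* t = ∏_{r ∈ M} (x + r) · t`) by the scalar
`dᵏ e_k(M) − C(d,k) e₁(M)ᵏ` (`e_k` the elementary symmetric functions): `R_k = dᵏ E_k − C(d,k) E₁ᵏ` with `E_k` the
elementary-symmetric operator extracted from the values at `x = 0..d` by a RATIONAL interpolation matrix `V` (taken as a
hypothesis; supplied by `exists_coeff_interpolation`). Their joint kernel is spanned by the "single-embedding" wedge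
monomials (module L3c/L3d: `work/andre/PLAN.md` §5).
-/

set_option linter.dupNamespace false

noncomputable section

namespace Summit.HodgeConjecture.HodgeConjecture.Theorems.HodgeAbelianVarieties.CMPivotAndre

open CategoryTheory Polynomial
open Literature.AlgebraicGeometry Literature.AlgebraicGeometry.Motives Literature.AlgebraicGeometry.HodgeTheory

/-- **The rational symmetric-function operators.** Given an endomorphism `Y` of `B`, a degree `d` and a rational
matrix `V` extracting coefficients of complex polynomials of degree `≤ d` from their values at `0, …, d`, there are
linear operators `R_k` on `Hᵈ(B(ℂ); ℂ)` preserving rational classes and Hodge types such that, whenever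
`(x•𝟙 + Y)^* t = ∏_{r∈M}(x + r) · t` for all `x : ℕ` (`M` a multiset of `d` complex numbers),
`R_k t = (dᵏ e_k(M) − C(d,k) e₁(M)ᵏ) · t` for every `k ≤ d`. [cite: Andre1992HodgeCM, Théorème]
[cite: Deligne1982HodgeCycles, §4 (4.4)] -/
theorem exists_andreSymmetricOperators : ∀ (d : ℕ) (B : Literature.AlgebraicGeometry.Motives.AbelianVariety ℂ) (Y : B ⟶ B) (V : Fin (d + 1) → Fin (d + 1) → ℚ), (∀ (h : Polynomial ℂ), h.natDegree ≤ d → ∀ k : Fin (d + 1), ∑ t : Fin (d + 1), (V k t : ℂ) * h.eval ((t : ℕ) : ℂ) = h.coeff (k : ℕ)) → ∃ R : ℕ → (Literature.AlgebraicGeometry.HodgeTheory.complexBetti B.X d →ₗ[ℂ] Literature.AlgebraicGeometry.HodgeTheory.complexBetti B.X d), (∀ k c, Literature.AlgebraicGeometry.HodgeTheory.IsRationalClass c → Literature.AlgebraicGeometry.HodgeTheory.IsRationalClass (R k c)) ∧ (∀ k (p q : ℕ) c, Literature.AlgebraicGeometry.HodgeTheory.IsOfHodgeType B.dim B.X d p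 q c → Literature.AlgebraicGeometry.HodgeTheory.IsOfHodgeType B.dim B.X d p q (R k c)) ∧ (∀ k, k ≤ d → ∀ (t : Literature.AlgebraicGeometry.HodgeTheory.complexBetti B.X d) (M : Multiset ℂ), M.card = d → (∀ x : ℕ, Literature.AlgebraicGeometry.HodgeTheory.complexBetti.map (x • 𝟙 B + Y).hom.hom.hom d t = (M.map fun r => (x : ℂ) + r).prod • t) → R k t = ((d : ℂ) ^ k * M.esymm k - (d.choose k : ℂ) * M.esymm 1 ^ k) • t) := by
  intro d B Y V hV
  classical
  have hB : IsSmoothProjective B.dim B.X := AbelianVariety.isSmoothProjective_holds (A := B)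
  -- the pull-backs `G x = (x•𝟙 + Y)^*` on `Hᵈ`
  let G : ℕ → (complexBetti B.X d →ₗ[ℂ] complexBetti B.X d) := fun x =>
    (complexBetti.map ((x • 𝟙 B + Y) : B ⟶ B).hom.hom.hom d).hom
  have hGapp : ∀ x c, G x c = complexBetti.map ((x • 𝟙 B + Y) : B ⟶ B).hom.hom.hom d c := fun x c => rfl
  -- "good" operators: preserve rational classes and Hodge types
  let Good : (complexBetti B.X d →ₗ[ℂ] complexBetti B.X d) → Prop := fun Q =>
    (∀ c, IsRationalClass c → IsRationalClass (Q c)) ∧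
      (∀ (p q : ℕ) c, IsOfHodgeType B.dim B.X d p q c → IsOfHodgeType B.dim B.X d p q (Q c))
  have hGoodG : ∀ x, Good (G x) := fun x =>
    ⟨fun c hc => by rw [hGapp]; exact hc.pullback _,
      fun p q c hc => by rw [hGapp]; exact hc.map_of_isSmoothProjective hB hB _⟩
  have hGood_zero : Good 0 := by
    refine ⟨fun c _ => ?_, fun p q c _ => ?_⟩
    · rw [LinearMap.zero_apply]; exact IsRationalClass.zero
    · rw [LinearMap.zero_apply]; exact IsOfHodgeType.zero (nonempty_hodgeModel_holds hB).some d p q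
  have hGood_add : ∀ Q Q', Good Q → Good Q' → Good (Q + Q') := fun Q Q' hQ hQ' =>
    ⟨fun c hc => by rw [LinearMap.add_apply]; exact (hQ.1 c hc).add (hQ'.1 c hc),
      fun p q c hc => by rw [LinearMap.add_apply]; exact IsOfHodgeType.add hB (hQ.2 p q c hc) (hQ'.2 p q c hc)⟩
  have hGood_smul : ∀ (a : ℚ) Q, Good Q → Good ((a : ℂ) • Q) := fun a Q hQ =>
    ⟨fun c hc => by rw [LinearMap.smul_apply]; exact (hQ.1 c hc).smul a,
      fun p q c hc => by rw [LinearMap.smul_apply]; exact IsOfHodgeType.smul (hQ.2 p q c hc) _⟩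
  have hGood_comp : ∀ Q Q', Good Q → Good Q' → Good (Q ∘ₗ Q') := fun Q Q' hQ hQ' =>
    ⟨fun c hc => by rw [LinearMap.comp_apply]; exact hQ.1 _ (hQ'.1 c hc),
      fun p q c hc => by rw [LinearMap.comp_apply]; exact hQ.2 p q _ (hQ'.2 p q c hc)⟩
  have hGood_sum : ∀ {J : Type} (s : Finset J) (Q : J → (complexBetti B.X d →ₗ[ℂ] complexBetti B.X d)),
      (∀ j ∈ s, Good (Q j)) → Good (∑ j ∈ s, Q j) := by
    intro J s Q hQ
    induction s using Finset.induction_on with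
    | empty => rw [Finset.sum_empty]; exact hGood_zero
    | insert a s ha ih =>
      rw [Finset.sum_insert ha]
      exact hGood_add _ _ (hQ a (Finset.mem_insert_self a s)) (ih fun j hj => hQ j (Finset.mem_insert_of_mem hj))
  have hGood_pow : ∀ Q (k : ℕ), Good Q → Good (Q ^ k) := by
    intro Q k hQ
    induction k with
    | zero =>
      rw [pow_zero]
      exact ⟨fun c hc => hc, fun p q c hc => hc⟩
    | succ k ih => rw [pow_succ]; exact hGood_comp _ _ ih hQ
  -- the elementary-symmetric operators `E k` (eigenvalue `e_k`) for `k ≤ d`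
  let E : ℕ → (complexBetti B.X d →ₗ[ℂ] complexBetti B.X d) := fun k =>
    if hk : k ≤ d then ∑ t : Fin (d + 1), ((V ⟨d - k, by omega⟩ t : ℚ) : ℂ) • G t else 0
  have hGoodE : ∀ k, Good (E k) := by
    intro k
    by_cases hk : k ≤ d
    · simp only [E, dif_pos hk]
      exact hGood_sum _ _ fun t _ => hGood_smul _ _ (hGoodG t)
    · simp only [E, dif_neg hk]
      exact hGood_zero
  -- the operators `R k = dᵏ E_k - C(d,k) E_1^k`
  let R : ℕ → (complexBetti B.X d →ₗ[ℂ] complexBetti B.X d) := fun k =>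
    (((d : ℚ) ^ k : ℚ) : ℂ) • E k + ((-(d.choose k : ℚ) : ℚ) : ℂ) • (E 1) ^ k
  have hGoodR : ∀ k, Good (R k) := fun k =>
    hGood_add _ _ (hGood_smul ((d : ℚ) ^ k) _ (hGoodE k))
      (hGood_smul (-(d.choose k : ℚ)) _ (hGood_pow _ k (hGoodE 1)))
  refine ⟨R, fun k => (hGoodR k).1, fun k => (hGoodR k).2, ?_⟩
  -- eigenvalues on a joint eigenvector with conjugate multiset `M`
  intro k hk t M hM hG
  -- the polynomial `h_M = ∏ (X + r)` and its values / coefficients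
  set h : Polynomial ℂ := (M.map fun r => X + C r).prod with hh
  have hmonic : ∀ f ∈ M.map (fun r => X + C r), Monic f := by
    intro f hf
    obtain ⟨r, _, rfl⟩ := Multiset.mem_map.mp hf
    exact monic_X_add_C r
  have hdeg : h.natDegree ≤ d := by
    rw [hh, natDegree_multiset_prod_of_monic _ hmonic, Multiset.map_map]
    have : (M.map (natDegree ∘ fun r => X + C r)) = M.map (fun _ => 1) := by
      refine Multiset.map_congr rfl fun r _ => ?_
      simp
    rw [this, Multiset.map_const', Multiset.sum_replicate, smul_eq_mul, mul_one, hM]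
  have heval : ∀ x : ℕ, h.eval ((x : ℕ) : ℂ) = (M.map fun r => (x : ℂ) + r).prod := by
    intro x
    rw [hh, eval_multiset_prod, Multiset.map_map]
    refine congrArg _ (Multiset.map_congr rfl fun r _ => ?_)
    simp
  have hcoeff : ∀ j, j ≤ d → h.coeff (d - j) = M.esymm j := by
    intro j hj
    rw [hh, Multiset.prod_X_add_C_coeff M (by rw [hM]; omega), hM]
    congr 1
    omega
  -- `E j t = e_j(M) • t` for `j ≤ d`
  have hE : ∀ j, j ≤ d → E j t = M.esymm j • t := by
    intro j hj
    simp only [E, dif_pos hj, LinearMap.coe_sum, Finset.sum_apply, LinearMap.smul_apply, hGapp, hG,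
      smul_smul]
    rw [← Finset.sum_smul]
    congr 1
    have := hV h hdeg ⟨d - j, by omega⟩
    simp only [heval] at this
    rw [this, hcoeff j hj]
  have hE1pow : ∀ m : ℕ, m ≤ d → ((E 1) ^ m) t = M.esymm 1 ^ m • t := by
    intro m hm
    induction m with
    | zero => rw [pow_zero, pow_zero, one_smul, Module.End.one_apply]
    | succ m ih =>
      rw [pow_succ, Module.End.mul_apply, hE 1 (by omega), map_smul, ih (by omega), smul_smul, pow_succ,
        mul_comm]
  show ((((d : ℚ) ^ k : ℚ) : ℂ) • E k + ((-(d.choose k : ℚ) : ℚ) : ℂ) • (E 1) ^ k) t = _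
  rw [LinearMap.add_apply, LinearMap.smul_apply, LinearMap.smul_apply, hE k hk, hE1pow k hk, smul_smul, smul_smul,
    ← add_smul]
  congr 1
  push_cast
  ring

end Summit.HodgeConjecture.HodgeConjecture.Theorems.HodgeAbelianVarieties.CMPivotAndre

end
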